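import Mathlib
import Summits.ValiantsHypothesis.ValiantsHypothesis.Theorems.KPlusLogSqLawStepSupStructure

/-!
# The TRIPLE LAW for three consecutive plateau steps (static path model behind `KPlusLogSqLaw.TropicalB`)

Cell pub-symmetroid, seat conjb-2 (g21). A helper toward the crux `TropicalB`
(`Summit.ValiantsHypothesis.ValiantsHypothesis.Theses.KPlusLogSqLaw.TropicalB`, item
`stmt-ValiantsHypothesis-19771`); it earns no crux credit and is not evidence for `MatrixDescartes` or for
Valiant's hypothesis.

Lines `S t θ = b t + s t * θ`, windows separated when the lines of the class `up` lie strictly above the others,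
`T[u, v]` = the separation set of the window `[u, v]`; a step at row `i` (reach `d`): `T[i, i+d]`, `T[i+1, i+d+1]`
non-empty and disjoint; row `i` has reach exactly `d` when moreover `[i, i+d+1]` is nowhere separated
(THEORY-NOTE-g21 §3).

THEOREM (TRIPLE LAW, THEORY-NOTE-g21 §3.1quinquies). If rows `i`, `i+1`, `i+2` all step (reach `d ≥ 2`, row `i` of
reach exactly `d`), then the comparison `c = S (i+d+1) - S (i+2)` of two lines of the SAME class has a forced slope
sign: `sign (s (i+d+1) - s (i+2))` is the direction of the step at row `i+1`. Mechanism: `c < 0` on `T[i, i+d]`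
(row-`i` exactness: there the new line `i+d+1` does not beat every lower line, while `i+2` does), and `c ≥ 0` at the
tight end `ρ₂` of `T[i+2, i+d+2]` facing `T[i+3, i+d+3]` (`step_sup_structure`: the outer line `i+2` meets a lower
line there while `i+d+1` still dominates it). If the steps at rows `i`, `i+1` go the same way, `T[i, i+d]` lies
beyond `T[i+2, i+d+2]` and the sign follows; if they go opposite ways, the look-back of the ZIGZAG LAW puts
`c (ρ₁) ≤ 0` at the tight end `ρ₁` of `T[i+1, i+d+1]`, `ρ₁ ≤ ρ₂`, and `c (ρ₁) = 0` is excluded because it would make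
the lines `i+1`, `i+2` meet at `ρ₁`, which the window `T[i, i+d]` beyond `ρ₁` forbids (in this case row-`i`
exactness is not used). Multiplying by the STEP
CRITERION at row `i+1` gives the parity-free form `(s (i+d+1) - s (i+2)) * (s (i+d+2) - s (i+1)) < 0`.

With the TWO-STEP PLATEAU CRITERION at `(i, i+1)` and `(i+1, i+2)` this is the located-exact THREE-STEP PLATEAU
CRITERION of §3.1quinquies (reach 3: 8 of 2 048 and 266 of 23 328 slope words; reach 5: 136 of 32 768); this file
and `KPlusLogSqLawStepTripleCases` prove the necessity of the new condition.

* `exact_row_gap` — row-`i` exactness gives `c < 0` on `T[i, i+d]`;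
* `triple_same_abstract`, `triple_zig_abstract` — the two affine sign arguments, over abstract tight points;
* `step_inf_structure` — the `θ ↦ -θ` mirror of `step_sup_structure` (tight structure at an infimum);
* `lookback_partner` — the look-back at row `i+1`: its tight partner is the new line `i+d+1`, with the facts at
  `r₁ = sup T[i+1, i+d+1]` in the original variables.
The four orientation theorems `triple_rrr`, `triple_rrl`, `triple_lrr`, `triple_lrl` (conclusion
`s (i+2) < s (i+d+1)`) are in `KPlusLogSqLawStepTripleCases`; the mirror images and the odd-first-line cases follow
by `θ ↦ -θ` and by negating all lines.
-/

set_option linter.dupNamespace false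

namespace Summit.ValiantsHypothesis.ValiantsHypothesis.Theorems.KPlusLogSqLawStepTriple

open Summit.ValiantsHypothesis.ValiantsHypothesis.Theorems.KPlusLogSqLawStepSupStructure (step_sup_structure)

/-- Row-`i` exactness: if `[i, i+d]` is separated at `θ` but `[i, i+d+1]` is not, and the new line `i+d+1` is an
upper line, then at `θ` it lies strictly below the upper line `i+2`. -/
theorem exact_row_gap (up : ℕ → Prop) (s b : ℕ → ℝ) (i d : ℕ) (θ : ℝ) (hd : 2 ≤ d) (hup2 : up (i + 2))
    (hup1 : up (i + d + 1))
    (hA : ∀ e o : ℕ, i ≤ e → e ≤ i + d → i ≤ o → o ≤ i + d → up e → ¬ up o →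
      b o + s o * θ < b e + s e * θ)
    (hex : ¬ (∀ e o : ℕ, i ≤ e → e ≤ i + d + 1 → i ≤ o → o ≤ i + d + 1 → up e → ¬ up o →
      b o + s o * θ < b e + s e * θ)) :
    b (i + d + 1) + s (i + d + 1) * θ < b (i + 2) + s (i + 2) * θ := by
  by_contra hge
  have hge' : b (i + 2) + s (i + 2) * θ ≤ b (i + d + 1) + s (i + d + 1) * θ := le_of_not_gt hge
  apply hex
  intro e o h1 h2 h3 h4 he ho
  have ho' : o ≤ i + d := by
    by_contra hoc
    have : o = i + d + 1 := by omega
    subst this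
    exact ho hup1
  by_cases hee : e ≤ i + d
  · exact hA e o h1 hee h3 ho' he ho
  · have : e = i + d + 1 := by omega
    subst this
    have h2o := hA (i + 2) o (by omega) (by omega) h3 ho' hup2 ho
    linarith

/-- Same-direction case, abstractly: `c < 0` at a point `θ₀` of `T[i, i+d]`, `c ≥ 0` at a point `ρ` at or to the
right of `θ₀` ⟹ `c` increases. -/
theorem triple_same_abstract (s b : ℕ → ℝ) (i d : ℕ) (θ₀ ρ : ℝ)
    (hc0 : b (i + d + 1) + s (i + d + 1) * θ₀ < b (i + 2) + s (i + 2) * θ₀) (hle : θ₀ ≤ ρ)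
    (hcρ : b (i + 2) + s (i + 2) * ρ ≤ b (i + d + 1) + s (i + d + 1) * ρ) :
    s (i + 2) < s (i + d + 1) := by
  by_contra hcon
  have hsl : s (i + d + 1) ≤ s (i + 2) := le_of_not_gt hcon
  have p : 0 ≤ (ρ - θ₀) * (s (i + 2) - s (i + d + 1)) := mul_nonneg (by linarith) (by linarith)
  have i1 : (b (i + d + 1) + s (i + d + 1) * ρ - (b (i + 2) + s (i + 2) * ρ))
      = (b (i + d + 1) + s (i + d + 1) * θ₀ - (b (i + 2) + s (i + 2) * θ₀))
        - (ρ - θ₀) * (s (i + 2) - s (i + d + 1)) := by ring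
  linarith

/-- Look-back case, abstractly. `r₁` is the tight end of `T[i+1, i+d+1]` (the upper line `i+d+1` meets the lower
line `i+1` there, `i+2` dominates, `T[i+1, i+d+1]` accumulates at `r₁` from the left with `S (i+1) < S (i+2)`),
`θ₀ ≥ r₁` is a point where `S (i+1) < S (i+2)` (a point of `T[i, i+d]`), and `ρ ≥ r₁` has `c (ρ) ≥ 0`. If `c` did
not increase, `c (r₁) = 0` would make the lines `i+1`, `i+2`, `i+d+1` concurrent at `r₁`, and the comparison of
`i+2` with `i+1` — positive just left of `r₁` — could not be positive at `θ₀`. (Row-`i` exactness is not needed in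
this case.) -/
theorem triple_zig_abstract (s b : ℕ → ℝ) (i d : ℕ) (r₁ ρ θ₀ : ℝ)
    (hq0 : b (i + 1) + s (i + 1) * θ₀ < b (i + 2) + s (i + 2) * θ₀) (hθ₀ : r₁ ≤ θ₀)
    (heq1 : b (i + d + 1) + s (i + d + 1) * r₁ = b (i + 1) + s (i + 1) * r₁)
    (hdom1 : b (i + 1) + s (i + 1) * r₁ ≤ b (i + 2) + s (i + 2) * r₁)
    (happ1 : ∀ ε : ℝ, 0 < ε → ∃ θ : ℝ,
      b (i + 1) + s (i + 1) * θ < b (i + 2) + s (i + 2) * θ ∧ r₁ - ε < θ ∧ θ ≤ r₁)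
    (hρ : r₁ ≤ ρ) (hcρ : b (i + 2) + s (i + 2) * ρ ≤ b (i + d + 1) + s (i + d + 1) * ρ) :
    s (i + 2) < s (i + d + 1) := by
  by_contra hcon
  have hsl : s (i + d + 1) ≤ s (i + 2) := le_of_not_gt hcon
  -- `c (ρ) ≤ c (r₁)`, hence `c (r₁) = 0`, i.e. the lines `i+1` and `i+2` meet at `r₁`
  have p : 0 ≤ (ρ - r₁) * (s (i + 2) - s (i + d + 1)) := mul_nonneg (by linarith) (by linarith)
  have i1 : (b (i + d + 1) + s (i + d + 1) * ρ - (b (i + 2) + s (i + 2) * ρ))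
      = (b (i + d + 1) + s (i + d + 1) * r₁ - (b (i + 2) + s (i + 2) * r₁))
        - (ρ - r₁) * (s (i + 2) - s (i + d + 1)) := by ring
  have hq1 : b (i + 1) + s (i + 1) * r₁ = b (i + 2) + s (i + 2) * r₁ := by linarith
  -- a point of `T[i+1, i+d+1]` just left of `r₁` makes `S (i+2) - S (i+1)` decrease, contradicting `θ₀ ≥ r₁`
  obtain ⟨θ, hqθ, -, hθle⟩ := happ1 1 one_pos
  have hne : θ ≠ r₁ := by
    intro h
    subst h
    linarith
  have hθlt : θ < r₁ := lt_of_le_of_ne hθle hne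
  -- slope of `q = S (i+2) - S (i+1)` is negative
  have hslq : s (i + 2) - s (i + 1) < 0 := by
    by_contra hq
    have hq' : 0 ≤ s (i + 2) - s (i + 1) := le_of_not_gt hq
    have p2 : 0 ≤ (r₁ - θ) * (s (i + 2) - s (i + 1)) := mul_nonneg (by linarith) hq'
    have i2 : (b (i + 2) + s (i + 2) * r₁ - (b (i + 1) + s (i + 1) * r₁))
        = (b (i + 2) + s (i + 2) * θ - (b (i + 1) + s (i + 1) * θ))
          + (r₁ - θ) * (s (i + 2) - s (i + 1)) := by ring
    linarith
  have p3 : 0 ≤ (θ₀ - r₁) * (s (i + 1) - s (i + 2)) := mul_nonneg (by linarith) (by linarith)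
  have i3 : (b (i + 2) + s (i + 2) * θ₀ - (b (i + 1) + s (i + 1) * θ₀))
      = (b (i + 2) + s (i + 2) * r₁ - (b (i + 1) + s (i + 1) * r₁))
        - (θ₀ - r₁) * (s (i + 1) - s (i + 2)) := by ring
  linarith

/-- Mirror (`θ ↦ -θ`) of `step_sup_structure`: the tight structure at the INFIMUM of `T[j, j+d]` when the next window
`T[j+1, j+d+1]` lies to its left. -/
theorem step_inf_structure (up : ℕ → Prop) (s b : ℕ → ℝ) (j d : ℕ) (hup0 : up j) (hup1 : up (j + d + 1))
    (hlow : ∃ o : ℕ, j + 1 ≤ o ∧ o ≤ j + d ∧ ¬ up o)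
    (hA : ∃ θ : ℝ, ∀ e o : ℕ, j ≤ e → e ≤ j + d → j ≤ o → o ≤ j + d → up e → ¬ up o →
      b o + s o * θ < b e + s e * θ)
    (hB : ∃ θ : ℝ, ∀ e o : ℕ, j + 1 ≤ e → e ≤ j + d + 1 → j + 1 ≤ o → o ≤ j + d + 1 → up e → ¬ up o →
      b o + s o * θ < b e + s e * θ)
    (hAB : ∀ θ : ℝ, ¬ ((∀ e o : ℕ, j ≤ e → e ≤ j + d → j ≤ o → o ≤ j + d → up e → ¬ up o →
      b o + s o * θ < b e + s e * θ) ∧ (∀ e o : ℕ, j + 1 ≤ e → e ≤ j + d + 1 → j + 1 ≤ o → o ≤ j + d + 1 →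
      up e → ¬ up o → b o + s o * θ < b e + s e * θ)))
    (hord : ∀ θ θ' : ℝ, (∀ e o : ℕ, j ≤ e → e ≤ j + d → j ≤ o → o ≤ j + d → up e → ¬ up o →
      b o + s o * θ < b e + s e * θ) → (∀ e o : ℕ, j + 1 ≤ e → e ≤ j + d + 1 → j + 1 ≤ o → o ≤ j + d + 1 →
      up e → ¬ up o → b o + s o * θ' < b e + s e * θ') → θ' < θ) :
    ∃ (r : ℝ) (o : ℕ), j + 1 ≤ o ∧ o ≤ j + d ∧ ¬ up o ∧
      b o + s o * r = b j + s j * r ∧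
      (∀ e o' : ℕ, j ≤ e → e ≤ j + d → j ≤ o' → o' ≤ j + d → up e → ¬ up o' →
        b o' + s o' * r ≤ b e + s e * r) ∧
      (∀ θ : ℝ, (∀ e o' : ℕ, j ≤ e → e ≤ j + d → j ≤ o' → o' ≤ j + d → up e → ¬ up o' →
        b o' + s o' * θ < b e + s e * θ) → r ≤ θ) ∧
      (∀ ε : ℝ, 0 < ε → ∃ θ : ℝ, (∀ e o' : ℕ, j ≤ e → e ≤ j + d → j ≤ o' → o' ≤ j + d → up e → ¬ up o' →
        b o' + s o' * θ < b e + s e * θ) ∧ θ < r + ε) ∧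
      (∀ θ' : ℝ, (∀ e o' : ℕ, j + 1 ≤ e → e ≤ j + d + 1 → j + 1 ≤ o' → o' ≤ j + d + 1 → up e → ¬ up o' →
        b o' + s o' * θ' < b e + s e * θ') → θ' < r) := by
  classical
  obtain ⟨θA, hθA⟩ := hA
  obtain ⟨θB, hθB⟩ := hB
  -- membership in the `θ ↦ -θ` picture
  have negA : ∀ θ : ℝ, (∀ e o' : ℕ, j ≤ e → e ≤ j + d → j ≤ o' → o' ≤ j + d → up e → ¬ up o' →
      b o' + -s o' * θ < b e + -s e * θ) ↔ (∀ e o' : ℕ, j ≤ e → e ≤ j + d → j ≤ o' → o' ≤ j + d → up e →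
      ¬ up o' → b o' + s o' * (-θ) < b e + s e * (-θ)) := by
    intro θ
    constructor
    · intro h e o' h1 h2 h3 h4 he ho'
      have := h e o' h1 h2 h3 h4 he ho'
      have r1 : s o' * (-θ) = -s o' * θ := by ring
      have r2 : s e * (-θ) = -s e * θ := by ring
      linarith
    · intro h e o' h1 h2 h3 h4 he ho'
      have := h e o' h1 h2 h3 h4 he ho'
      have r1 : s o' * (-θ) = -s o' * θ := by ring
      have r2 : s e * (-θ) = -s e * θ := by ring
      linarith
  have negB : ∀ θ : ℝ, (∀ e o' : ℕ, j + 1 ≤ e → e ≤ j + d + 1 → j + 1 ≤ o' → o' ≤ j + d + 1 → up e →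
      ¬ up o' → b o' + -s o' * θ < b e + -s e * θ) ↔ (∀ e o' : ℕ, j + 1 ≤ e → e ≤ j + d + 1 → j + 1 ≤ o' →
      o' ≤ j + d + 1 → up e → ¬ up o' → b o' + s o' * (-θ) < b e + s e * (-θ)) := by
    intro θ
    constructor
    · intro h e o' h1 h2 h3 h4 he ho'
      have := h e o' h1 h2 h3 h4 he ho'
      have r1 : s o' * (-θ) = -s o' * θ := by ring
      have r2 : s e * (-θ) = -s e * θ := by ring
      linarith
    · intro h e o' h1 h2 h3 h4 he ho'
      have := h e o' h1 h2 h3 h4 he ho'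
      have r1 : s o' * (-θ) = -s o' * θ := by ring
      have r2 : s e * (-θ) = -s e * θ := by ring
      linarith
  have hA' : ∀ e o' : ℕ, j ≤ e → e ≤ j + d → j ≤ o' → o' ≤ j + d → up e → ¬ up o' →
      b o' + -s o' * (-θA) < b e + -s e * (-θA) := by
    rw [negA]; simpa using hθA
  have hB' : ∀ e o' : ℕ, j + 1 ≤ e → e ≤ j + d + 1 → j + 1 ≤ o' → o' ≤ j + d + 1 → up e → ¬ up o' →
      b o' + -s o' * (-θB) < b e + -s e * (-θB) := by
    rw [negB]; simpa using hθB
  obtain ⟨r, o, ho1, ho2, hou, -, -, heq, hdom, hsup, happ, hgt⟩ :=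
    step_sup_structure up (fun t => - s t) b j d hup0 hup1 hlow ⟨-θA, hA'⟩ ⟨-θB, hB'⟩
      (fun θ hθ => hAB (-θ) ⟨(negA θ).1 hθ.1, (negB θ).1 hθ.2⟩)
      (fun θ θ' hθ hθ' => by
        have := hord (-θ) (-θ') ((negA θ).1 hθ) ((negB θ').1 hθ')
        linarith)
  refine ⟨-r, o, ho1, ho2, hou, ?_, ?_, ?_, ?_, ?_⟩
  · have r1 : s o * (-r) = -s o * r := by ring
    have r2 : s j * (-r) = -s j * r := by ring
    linarith
  · intro e o' h1 h2 h3 h4 he ho'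
    have := hdom e o' h1 h2 h3 h4 he ho'
    have r1 : s o' * (-r) = -s o' * r := by ring
    have r2 : s e * (-r) = -s e * r := by ring
    linarith
  · intro θ hθ
    have hθ' : ∀ e o' : ℕ, j ≤ e → e ≤ j + d → j ≤ o' → o' ≤ j + d → up e → ¬ up o' →
        b o' + -s o' * (-θ) < b e + -s e * (-θ) := by
      rw [negA]; simpa using hθ
    have := hsup (-θ) hθ'
    linarith
  · intro ε hε
    obtain ⟨φ, hφ, hφlt⟩ := happ ε hε
    exact ⟨-φ, (negA φ).1 hφ, by linarith⟩
  · intro θ' hθ'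
    have h' : ∀ e o' : ℕ, j + 1 ≤ e → e ≤ j + d + 1 → j + 1 ≤ o' → o' ≤ j + d + 1 → up e → ¬ up o' →
        b o' + -s o' * (-θ') < b e + -s e * (-θ') := by
      rw [negB]; simpa using hθ'
    have := hgt (-θ') h'
    linarith

/-- LOOK-BACK at row `i+1` (lower outer line `i+1`, its step moving right, `T[i, i+d]` to the right of
`T[i+1, i+d+1]`): the tight end `r₁ = sup T[i+1, i+d+1]`, where the new upper line `i+d+1` meets the line `i+1`,
every upper line of `[i+1, i+d+1]` dominates every lower one, `T[i+1, i+d+1]` accumulates from the left,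
`T[i+2, i+d+2]` lies strictly beyond, and `T[i, i+d]` lies at or beyond `r₁`. -/
theorem lookback_partner (up : ℕ → Prop) (s b : ℕ → ℝ) (i d : ℕ) (hd : 1 ≤ d) (hlow1 : ¬ up (i + 1))
    (hup2 : up (i + 2)) (hlow2 : ¬ up (i + d + 2))
    (hA0 : ∃ θ : ℝ, ∀ e o : ℕ, i ≤ e → e ≤ i + d → i ≤ o → o ≤ i + d → up e → ¬ up o →
      b o + s o * θ < b e + s e * θ)
    (hA1 : ∃ θ : ℝ, ∀ e o : ℕ, i + 1 ≤ e → e ≤ i + d + 1 → i + 1 ≤ o → o ≤ i + d + 1 → up e → ¬ up o →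
      b o + s o * θ < b e + s e * θ)
    (hA2 : ∃ θ : ℝ, ∀ e o : ℕ, i + 2 ≤ e → e ≤ i + d + 2 → i + 2 ≤ o → o ≤ i + d + 2 → up e → ¬ up o →
      b o + s o * θ < b e + s e * θ)
    (hord10 : ∀ θ θ' : ℝ, (∀ e o : ℕ, i + 1 ≤ e → e ≤ i + d + 1 → i + 1 ≤ o → o ≤ i + d + 1 → up e → ¬ up o →
      b o + s o * θ < b e + s e * θ) → (∀ e o : ℕ, i ≤ e → e ≤ i + d → i ≤ o → o ≤ i + d →
      up e → ¬ up o → b o + s o * θ' < b e + s e * θ') → θ < θ')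
    (hA12 : ∀ θ : ℝ, ¬ ((∀ e o : ℕ, i + 1 ≤ e → e ≤ i + d + 1 → i + 1 ≤ o → o ≤ i + d + 1 → up e → ¬ up o →
      b o + s o * θ < b e + s e * θ) ∧ (∀ e o : ℕ, i + 2 ≤ e → e ≤ i + d + 2 → i + 2 ≤ o → o ≤ i + d + 2 →
      up e → ¬ up o → b o + s o * θ < b e + s e * θ)))
    (hord12 : ∀ θ θ' : ℝ, (∀ e o : ℕ, i + 1 ≤ e → e ≤ i + d + 1 → i + 1 ≤ o → o ≤ i + d + 1 → up e → ¬ up o →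
      b o + s o * θ < b e + s e * θ) → (∀ e o : ℕ, i + 2 ≤ e → e ≤ i + d + 2 → i + 2 ≤ o → o ≤ i + d + 2 →
      up e → ¬ up o → b o + s o * θ' < b e + s e * θ') → θ < θ') :
    ∃ r₁ : ℝ, b (i + d + 1) + s (i + d + 1) * r₁ = b (i + 1) + s (i + 1) * r₁ ∧
      s (i + d + 2) < s (i + d + 1) ∧ s (i + d + 1) < s (i + 1) ∧
      (∀ e o : ℕ, i + 1 ≤ e → e ≤ i + d + 1 → i + 1 ≤ o → o ≤ i + d + 1 → up e → ¬ up o →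
        b o + s o * r₁ ≤ b e + s e * r₁) ∧
      (∀ θ : ℝ, (∀ e o : ℕ, i + 1 ≤ e → e ≤ i + d + 1 → i + 1 ≤ o → o ≤ i + d + 1 → up e → ¬ up o →
        b o + s o * θ < b e + s e * θ) → θ ≤ r₁) ∧
      (∀ ε : ℝ, 0 < ε → ∃ θ : ℝ, (∀ e o : ℕ, i + 1 ≤ e → e ≤ i + d + 1 → i + 1 ≤ o → o ≤ i + d + 1 →
        up e → ¬ up o → b o + s o * θ < b e + s e * θ) ∧ r₁ - ε < θ) ∧
      (∀ θ' : ℝ, (∀ e o : ℕ, i + 2 ≤ e → e ≤ i + d + 2 → i + 2 ≤ o → o ≤ i + d + 2 → up e → ¬ up o →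
        b o + s o * θ' < b e + s e * θ') → r₁ < θ') ∧
      (∀ θ : ℝ, (∀ e o : ℕ, i ≤ e → e ≤ i + d → i ≤ o → o ≤ i + d → up e → ¬ up o →
        b o + s o * θ < b e + s e * θ) → r₁ ≤ θ) := by
  classical
  obtain ⟨θ₀, hθ₀⟩ := hA0
  obtain ⟨θ₁, hθ₁⟩ := hA1
  obtain ⟨θ₂, hθ₂⟩ := hA2
  -- structure theorem for row `i+1` on the negated lines (classes swapped; its step moves right)
  have hlowA : ∃ x : ℕ, i + 1 + 1 ≤ x ∧ x ≤ i + 1 + d ∧ ¬ (¬ up x) := ⟨i + 2, by omega, by omega, fun h => h hup2⟩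
  have hlow2' : ¬ up (i + 1 + d + 1) := by
    rw [show i + 1 + d + 1 = i + d + 2 by omega]; exact hlow2
  -- membership in the negated picture
  have memB : ∀ θ : ℝ, (∀ e o' : ℕ, i + 1 ≤ e → e ≤ i + 1 + d → i + 1 ≤ o' → o' ≤ i + 1 + d → ¬ up e →
      ¬ ¬ up o' → -b o' + -s o' * θ < -b e + -s e * θ) ↔ (∀ e o : ℕ, i + 1 ≤ e → e ≤ i + d + 1 → i + 1 ≤ o →
      o ≤ i + d + 1 → up e → ¬ up o → b o + s o * θ < b e + s e * θ) := by
    intro θ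
    constructor
    · intro h e o h1 h2 h3 h4 he ho
      have := h o e h3 (by omega) h1 (by omega) ho (not_not.mpr he)
      have r1 : -s o * θ = -(s o * θ) := by ring
      have r2 : -s e * θ = -(s e * θ) := by ring
      linarith
    · intro h e o' h1 h2 h3 h4 he ho'
      have := h o' e h3 (by omega) h1 (by omega) (not_not.mp ho') he
      have r1 : -s o' * θ = -(s o' * θ) := by ring
      have r2 : -s e * θ = -(s e * θ) := by ring
      linarith
  have memC : ∀ θ : ℝ, (∀ e o' : ℕ, i + 1 + 1 ≤ e → e ≤ i + 1 + d + 1 → i + 1 + 1 ≤ o' → o' ≤ i + 1 + d + 1 →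
      ¬ up e → ¬ ¬ up o' → -b o' + -s o' * θ < -b e + -s e * θ) ↔ (∀ e o : ℕ, i + 2 ≤ e → e ≤ i + d + 2 →
      i + 2 ≤ o → o ≤ i + d + 2 → up e → ¬ up o → b o + s o * θ < b e + s e * θ) := by
    intro θ
    constructor
    · intro h e o h1 h2 h3 h4 he ho
      have := h o e (by omega) (by omega) (by omega) (by omega) ho (not_not.mpr he)
      have r1 : -s o * θ = -(s o * θ) := by ring
      have r2 : -s e * θ = -(s e * θ) := by ring
      linarith
    · intro h e o' h1 h2 h3 h4 he ho'
      have := h o' e (by omega) (by omega) (by omega) (by omega) (not_not.mp ho') he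
      have r1 : -s o' * θ = -(s o' * θ) := by ring
      have r2 : -s e * θ = -(s e * θ) := by ring
      linarith
  obtain ⟨r₁, x, hx1, hx2, hxu, hsx1, hsx2, hxeq, hdom1, hsup1, happ1, hgt1⟩ :=
    step_sup_structure (fun n => ¬ up n) (fun t => - s t) (fun t => - b t) (i + 1) d hlow1 hlow2' hlowA
      ⟨θ₁, (memB θ₁).2 hθ₁⟩ ⟨θ₂, (memC θ₂).2 hθ₂⟩
      (fun θ hθ => hA12 θ ⟨(memB θ).1 hθ.1, (memC θ).1 hθ.2⟩)
      (fun θ θ' hθ hθ' => hord12 θ θ' ((memB θ).1 hθ) ((memC θ').1 hθ'))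
  -- `θ₀ ≥ r₁`, and in general every point of `T[i, i+d]` is `≥ r₁`
  have hright : ∀ θ : ℝ, (∀ e o : ℕ, i ≤ e → e ≤ i + d → i ≤ o → o ≤ i + d → up e → ¬ up o →
      b o + s o * θ < b e + s e * θ) → r₁ ≤ θ := by
    intro θ hθ
    by_contra hcon
    have hlt : θ < r₁ := lt_of_not_ge hcon
    obtain ⟨φ, hφ, hφlt⟩ := happ1 (r₁ - θ) (by linarith)
    have := hord10 φ θ ((memB φ).1 hφ) hθ
    linarith
  have hθ₀r : r₁ ≤ θ₀ := hright θ₀ hθ₀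
  -- look-back: the tight partner `x` of the line `i+1` is the line `i+d+1`
  have hx : x = i + d + 1 := by
    by_contra hne
    have hxle : x ≤ i + d := by omega
    have dA := hθ₀ x (i + 1) (by omega) hxle (by omega) (by omega) (not_not.mp hxu) hlow1
    have hslope : s x < s (i + 1) := by
      have := hsx1
      linarith
    have p : 0 ≤ (θ₀ - r₁) * (s (i + 1) - s x) := mul_nonneg (by linarith) (by linarith)
    have i1 : (b x + s x * θ₀) - (b (i + 1) + s (i + 1) * θ₀)
        = ((b x + s x * r₁) - (b (i + 1) + s (i + 1) * r₁)) - (θ₀ - r₁) * (s (i + 1) - s x) := by ring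
    have heq : (b x + s x * r₁) - (b (i + 1) + s (i + 1) * r₁) = 0 := by
      have := hxeq
      have r1 : -s x * r₁ = -(s x * r₁) := by ring
      have r2 : -s (i + 1) * r₁ = -(s (i + 1) * r₁) := by ring
      linarith
    linarith
  subst hx
  refine ⟨r₁, ?_, ?_, ?_, ?_, ?_, ?_, ?_, hright⟩
  · have := hxeq
    have r1 : -s (i + d + 1) * r₁ = -(s (i + d + 1) * r₁) := by ring
    have r2 : -s (i + 1) * r₁ = -(s (i + 1) * r₁) := by ring
    linarith
  · have := hsx2
    rw [show i + 1 + d + 1 = i + d + 2 by omega] at this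
    linarith
  · have := hsx1
    linarith
  · intro e o h1 h2 h3 h4 he ho
    have := hdom1 o e h3 (by omega) h1 (by omega) ho (not_not.mpr he)
    have r1 : -s o * r₁ = -(s o * r₁) := by ring
    have r2 : -s e * r₁ = -(s e * r₁) := by ring
    linarith
  · intro θ hθ
    exact hsup1 θ ((memB θ).2 hθ)
  · intro ε hε
    obtain ⟨φ, hφ, hφlt⟩ := happ1 ε hε
    exact ⟨φ, (memB φ).1 hφ, hφlt⟩
  · intro θ' hθ'
    exact hgt1 θ' ((memC θ').2 hθ')

end Summit.ValiantsHypothesis.ValiantsHypothesis.Theorems.KPlusLogSqLawStepTriple
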